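import Summits.QuantumFields.YangMills.Theorems.UnitScaleTiltProp7PinnedHarmonicMeasure
import Summits.QuantumFields.YangMills.Theorems.UnitScaleTiltProp7CovHodgeSplit
import Literature.MathematicalPhysics.QuantumFieldTheory.Balaban1983to89.B9Eq310Hermitian
import Literature.MathematicalPhysics.QuantumFieldTheory.Balaban1983to89.B15Prop1DatumSmall7AtZSequence
import Literature.MathematicalPhysics.QuantumFieldTheory.Balaban1983to89.B10Eq41TorusHistories
import HarnessLib

/-!
# Route `UnitScaleTilt`, crux K1 «MinimiserStabilityRegPr» (stmt-QuantumFields-19200), line «route-R» (S2, curved Hodge route) — THE φ-SIZE LETTER, file 2∕2: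
# a matrix site field that is COVARIANTLY HARMONIC OFF the k-centres has operator-norm `ℓ²`-mass at most `L^{3k}` times the `ℓ²`-mass of its CENTRE VALUES,
# `Σ_x ‖φ(x)‖² ≤ (L^k)³·Σ_{y ∈ T^{(k)}} ‖φ(ι_k y)‖²`, at ANY `SU(2)` background — k-UNIFORM and VOLUME-FREE

Cell `ym3-torus`, D-0154 (3c) twin-width seat `ym-routeR-w1` (gen 0, session 2); `--supports stmt-QuantumFields-19200 --as helper`; THEOREMS ONLY (0 `def`, 0 `sorry`).
YM₃ on T³ is a ladder rung (R3), not the Clay problem; nothing here claims the stub, the crux, d = 4 or the mass gap.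

WHY (numbers).  The curved Hodge route of stub P splits the pinned representative's `Y` as `B + D_{U₀}φ` (✓ p610574) with `Δ_{U₀}φ = D^*_{U₀}Y` supported on the k-centres (the
pinned slice: lattice Landau gauge OFF the centres), reads the constraint on the parts (✓ p611528), and meets ONE curved term with no flat counterpart, the curvature commutator
`‖(curl_{U₀} D_{U₀}φ)(p)‖ ≤ 2‖U₀(∂p) − 1‖·‖φ(x_p)‖` (✓ p601297): it sees the VALUE `φ(x_p)`.  This file turns `Σ_x‖φ(x)‖²` into a CENTRE-VALUE quantity:
`Σ_x‖φ(x)‖² ≤ L^{3k}·Σ_y‖φ(ι_k y)‖²`, so that with `‖U₀(∂p) − 1‖ ≤ a = ε₀L^{−2k}` the commutator energy is `≤ 4a²·3·Σ_x‖φ‖² ≤ 12·ε₀²·L^{−k}·Σ_y‖φ(ι_k y)‖²` — the currency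
of the constraint row (ε), whose coarse data are `Λ − φ∘ι_k`.  (The LOCATED caution of memo #51 §3 thus moves from the fine values of `φ` to its centre values; the
control of the centre values themselves runs through the constraint and is NOT in this file.)

WHAT IS PROVED (sorry-free, no definition).
* §3 (any normed ring that is a normed `ℂ`-algebra; background units of norm `≤ 1` with inverses of norm `≤ 1`, e.g. unitary matrices in the operator norm): `covLaplace_apply`
  (`(D^*_UD_Uφ)(x) = Σ_μ((φ(x)+φ(x)) − (R(U_μ(x−e_μ))⁻¹φ(x−e_μ) + R(U_μ(x))φ(x+e_μ)))` in `B9Eq39Adjoint`'s letters `covD`∕`covDstar`∕`divB`∕`R` on `torusT`);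
  ★ `norm_subMean_of_covLaplace_eq_zero` — KATO: `(D^*_UD_Uφ)(x) = 0` ⇒ `2d·‖φ(x)‖ ≤ Σ_μ(‖φ(x+e_μ)‖ + ‖φ(x−e_μ)‖)` (`B9Eq310Hermitian.norm_R_le`);
  ★★★ `card_mul_sum_norm_sq_le_of_covHarmonic_off` — `|C|·Σ_x‖φ(x)‖² ≤ |T^{(j)}|·Σ_{c∈C}‖φ(c)‖²` for `φ` covariantly harmonic off a nonempty homogeneous `C` (file 1∕2
  `Prop7PinnedHarmonicMeasure.card_mul_sum_sq_le_of_subMean_off` at `u = ‖φ‖`).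
* §4 the T³ reading (`B15DeterminingSets.embIter`, `Site.scaleTo`, `B15Prop1DatumSmall7AtZSequence.embIter_add`): `mem_centres_iff_add_scaleTo`, `centres_homogeneous` (the
  `k`-centres are exchanged by the translations `ι_k(a)`), `card_centres_mul_pow` (`|C|·(L^d)^k = |T_η|`, `B10Eq41TorusHistories.card_site_mul_pow`);
  ★★★ `sum_norm_sq_le_pow_mul_sum_centres_T3` — run `K` of a T³ family, `SU(2)` background `U₀` (p483802's letters `unitsField (toUField U₀)`, `torusT`), `k ≤ m + K`:
  `Σ_x‖φ(x)‖² ≤ (F.L^k)³·Σ_{y : T^{(k)}}‖φ(ι_k y)‖²` whenever `(D^*_{U₀}D_{U₀}φ)(x) = 0` off `Set.range (embIter k)`.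

HONEST SCOPE.  Elementary ([folklore]: Kato's inequality for covariant lattice Laplacians + file 1∕2); no estimate of Bałaban's is asserted; this is ONE input letter of the curved
N7 assembly, not the assembly.

References: T. Bałaban, CMP 99 (1985) 389–434 [Balaban1985BackgroundPropagators] ((3.3) p.390, (3.8) p.392); CMP 102 (1985) 277–309 [Balaban1985Variational] (Prop. 7
p.299, (141)–(143)); Commun. Math. Phys. 109 (1987) 249–301 [Balaban1987RG1] ((0.1) p.251: the lattices of centres).
-/

set_option autoImplicit false

noncomputable section

open scoped BigOperators Matrix.Norms.L2Operator Matrix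

namespace Summit.QuantumFields.YangMills.Theorems.Prop7PinnedHarmonicMass

open Literature.MathematicalPhysics.QuantumFieldTheory.Balaban1983to89
open Finset LatticeFieldCalculus
open B9Eq39Adjoint (R covD covDstar divB)
open B9TorusCalculus (torusT torusT_apply torusT_symm_apply)
open Summit.QuantumFields.YangMills.Theorems.Prop7PinnedHarmonicMeasure (card_mul_sum_sq_le_of_subMean_off)

/-! ## §3 The covariant layer: Kato's inequality for `Δ_U = D^*_U D_U` at a background of norm-one units -/

section Covariant

variable {𝔸 : Type*} [NormedRing 𝔸] [NormedAlgebra ℂ 𝔸] {P : Params} {j : ℕ}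

omit [NormedAlgebra ℂ 𝔸] in
/-- **THE COVARIANT LAPLACIAN, UNFOLDED**: `(D^*_U D_U φ)(x) = Σ_μ ((φ(x) + φ(x)) − (R(U(x−e_μ,x))φ(x−e_μ) + R(U(x,x+e_μ))φ(x+e_μ)))` (`R(U(x−e_μ,x)) = R(U_μ(x−e_μ))⁻¹`).
[cite: Balaban1985BackgroundPropagators, (3.3) p.390, (3.8) p.392] -/
theorem covLaplace_apply (U : Fin P.d → Site P j → 𝔸ˣ) (φ : Site P j → 𝔸) (x : Site P j) :
    divB (torusT P j) U (fun μ => covD (torusT P j) U μ φ) x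
      = ∑ μ : Fin P.d, ((φ x + φ x) - (R (U μ (x.unshift μ))⁻¹ (φ (x.unshift μ)) + R (U μ x) (φ (x.shift μ)))) := by
  unfold divB
  refine Finset.sum_congr rfl fun μ _ => ?_
  simp only [covDstar, B9Eq39Adjoint.covD, torusT_symm_apply, torusT_apply, Site.shift_unshift, B9Eq39Adjoint.R_sub, B9Eq39Adjoint.R_inv_R]
  abel

/-- ★ **KATO'S INEQUALITY**: at a background of units of norm `≤ 1` with inverses of norm `≤ 1` (unitary matrices in the operator norm), a site field with `(D^*_U D_U φ)(x) = 0`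
is sub-mean-value in norm at `x`: `2d·‖φ(x)‖ ≤ Σ_μ (‖φ(x+e_μ)‖ + ‖φ(x−e_μ)‖)`. [folklore] -/
theorem norm_subMean_of_covLaplace_eq_zero (U : Fin P.d → Site P j → 𝔸ˣ)
    (hU : ∀ (κ : Fin P.d) (y : Site P j), ‖(U κ y : 𝔸)‖ ≤ 1 ∧ ‖(((U κ y)⁻¹ : 𝔸ˣ) : 𝔸)‖ ≤ 1)
    (φ : Site P j → 𝔸) (x : Site P j) (hx : divB (torusT P j) U (fun μ => covD (torusT P j) U μ φ) x = 0) :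
    2 * (P.d : ℝ) * ‖φ x‖ ≤ ∑ μ : Fin P.d, (‖φ (x.shift μ)‖ + ‖φ (x.unshift μ)‖) := by
  rw [covLaplace_apply, Finset.sum_sub_distrib, sub_eq_zero] at hx
  -- `Σ_μ (φ x + φ x) = (2d)•φ x`
  have hlhs : ∑ μ : Fin P.d, (φ x + φ x) = ((2 * (P.d : ℝ) : ℝ) : ℂ) • φ x := by
    rw [Finset.sum_const, Finset.card_univ, Fintype.card_fin, ← two_smul ℂ (φ x), ← Nat.cast_smul_eq_nsmul ℂ, smul_smul]
    congr 1
    push_cast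
    ring
  have hnorm : ‖∑ μ : Fin P.d, (φ x + φ x)‖ = 2 * (P.d : ℝ) * ‖φ x‖ := by
    rw [hlhs, norm_smul]
    congr 1
    rw [show ((2 * (P.d : ℝ) : ℝ) : ℂ) = ((2 * P.d : ℕ) : ℂ) by push_cast; ring, Complex.norm_natCast]
    push_cast
    ring
  rw [← hnorm, hx]
  refine (norm_sum_le _ _).trans (Finset.sum_le_sum fun μ _ => (norm_add_le _ _).trans ?_)
  rw [add_comm]
  refine add_le_add ?_ ?_
  · exact B9Eq310Hermitian.norm_R_le (hU μ x).1 (hU μ x).2 _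
  · refine B9Eq310Hermitian.norm_R_le (hU μ (x.unshift μ)).2 ?_ _
    rw [inv_inv]
    exact (hU μ (x.unshift μ)).1

/-- ★★★ **THE φ-SIZE LETTER, COVARIANT FORM**: at a background of norm-one units on `T^{(j)}`, a site field that is covariantly harmonic off a nonempty HOMOGENEOUS centre set `C`
(`(D^*_U D_U φ)(x) = 0` for `x ∉ C`; every two centres exchanged by a `C`-preserving translation) satisfies `|C|·Σ_x ‖φ(x)‖² ≤ |T^{(j)}|·Σ_{c∈C} ‖φ(c)‖²`.
[folklore] [cite: Balaban1985BackgroundPropagators, (3.8) p.392] -/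
theorem card_mul_sum_norm_sq_le_of_covHarmonic_off (U : Fin P.d → Site P j → 𝔸ˣ)
    (hU : ∀ (κ : Fin P.d) (y : Site P j), ‖(U κ y : 𝔸)‖ ≤ 1 ∧ ‖(((U κ y)⁻¹ : 𝔸ˣ) : 𝔸)‖ ≤ 1)
    (C : Finset (Site P j)) (hC : C.Nonempty)
    (htrans : ∀ c ∈ C, ∀ c' ∈ C, ∃ a : Site P j, (∀ x : Site P j, x ∈ C ↔ x + a ∈ C) ∧ c + a = c')
    (φ : Site P j → 𝔸) (hφ : ∀ x : Site P j, x ∉ C → divB (torusT P j) U (fun μ => covD (torusT P j) U μ φ) x = 0) :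
    (C.card : ℝ) * ∑ x : Site P j, ‖φ x‖ ^ 2 ≤ (Fintype.card (Site P j) : ℝ) * ∑ c ∈ C, ‖φ c‖ ^ 2 :=
  card_mul_sum_sq_le_of_subMean_off C hC htrans (fun y => ‖φ y‖) (fun _ => norm_nonneg _)
    fun x hx => norm_subMean_of_covLaplace_eq_zero U hU φ x (hφ x hx)

end Covariant

/-! ## §4 The T³ reading: the `k`-centres of the finest torus of a T³ family, `SU(2)` background -/

section T3

open Literature.MathematicalPhysics.QuantumFieldTheory.Balaban1983to89.T3ContinuumYM3Torus
open B10Eq27TorusAxialLog (unitsField toUField)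
open B15DeterminingSets (embIter)
open B15Prop1DatumSmall7AtZSequence (embIter_add)
open Summit.QuantumFields.YangMills.Theorems.Prop7CovariantCoercivity (mem_U1_of_unitary)
open Summit.QuantumFields.YangMills.Theorems.Prop7CovHodgeSplit (unitsField_toUField_mem_unitary)

variable {P : Params}

/-- translations by `L^k`-multiples of lattice vectors preserve the set of `k`-centres: `x` is a `k`-centre iff `x + ι_k(a)` is (`ι_k(y + a) = ι_k y + L^k a`).
[cite: Balaban1987RG1, (0.1) p.251] -/
theorem mem_centres_iff_add_scaleTo (k : ℕ) (a : Site P k) (x : Site P 0) :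
    x ∈ (Finset.univ : Finset (Site P k)).image (embIter k) ↔ x + Site.scaleTo k a ∈ (Finset.univ : Finset (Site P k)).image (embIter k) := by
  simp only [Finset.mem_image, Finset.mem_univ, true_and]
  constructor
  · rintro ⟨y, rfl⟩
    exact ⟨y + a, embIter_add k y a⟩
  · rintro ⟨y, hy⟩
    refine ⟨y + (-a), ?_⟩
    rw [embIter_add, hy, map_neg, add_neg_cancel_right]

/-- the `k`-centres form a HOMOGENEOUS set: any two are exchanged by a centre-preserving translation of the finest torus. [cite: Balaban1987RG1, (0.1) p.251] -/
theorem centres_homogeneous (k : ℕ) :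
    ∀ c ∈ (Finset.univ : Finset (Site P k)).image (embIter k), ∀ c' ∈ (Finset.univ : Finset (Site P k)).image (embIter k),
      ∃ a : Site P 0, (∀ x : Site P 0, x ∈ (Finset.univ : Finset (Site P k)).image (embIter k) ↔
        x + a ∈ (Finset.univ : Finset (Site P k)).image (embIter k)) ∧ c + a = c' := by
  intro c hc c' hc'
  simp only [Finset.mem_image, Finset.mem_univ, true_and] at hc hc'
  obtain ⟨y, rfl⟩ := hc
  obtain ⟨y', rfl⟩ := hc'
  refine ⟨Site.scaleTo k (y' - y), fun x => mem_centres_iff_add_scaleTo k (y' - y) x, ?_⟩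
  rw [← embIter_add, add_sub_cancel]

/-- the number of `k`-centres times `L^{dk}` is the number of sites of the finest torus (`k ≤ m + K`). [cite: Balaban1987RG1, (0.1) p.251] -/
theorem card_centres_mul_pow {k : ℕ} (hk : k ≤ P.m + P.K) :
    ((Finset.univ : Finset (Site P k)).image (embIter k)).card * (P.L ^ P.d) ^ k = Fintype.card (Site P 0) := by
  have hinj : ∀ {i : ℕ}, i ≤ P.m + P.K → Function.Injective (embIter (P := P) i) := by
    intro i
    induction i with
    | zero => intro _ x y h; exact h
    | succ i ih =>
      intro hi x y h
      have h' : emb x = emb y := ih (Nat.le_of_succ_le hi) h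
      rw [← Site.blockOf_emb hi x, ← Site.blockOf_emb hi y, h']
  rw [Finset.card_image_of_injective _ (hinj hk), Finset.card_univ]
  exact B10Eq41TorusHistories.card_site_mul_pow hk

/-- ★★★ **THE φ-SIZE LETTER ON THE T³ CARRIER** (run `K` of a T³ family, `SU(2)` background `U₀` in p483802's letters, `k ≤ m + K`): a matrix site field on the finest torus that is
covariantly harmonic off the `k`-centres — `(D^*_{U₀} D_{U₀} φ)(x) = 0` for `x ∉ ι_k(T^{(k)})`, the pinned Hodge potential of (δ)∕(ε) — has
`Σ_x ‖φ(x)‖² ≤ (L^k)³·Σ_{y ∈ T^{(k)}} ‖φ(ι_k y)‖²` (operator norms), uniformly in `k` and in the volume.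
[folklore] [cite: Balaban1985BackgroundPropagators, (3.8) p.392; Balaban1985Variational, Prop. 7 p.299] -/
theorem sum_norm_sq_le_pow_mul_sum_centres_T3 (F : T3Family) (K k : ℕ) (hk : k ≤ F.m + K)
    (U₀ : GaugeField (F.P K) 0 (Matrix.specialUnitaryGroup (Fin 2) ℂ)) (φ : Site (F.P K) 0 → Matrix (Fin 2) (Fin 2) ℂ)
    (hφ : ∀ x : Site (F.P K) 0, x ∉ Set.range (embIter k) →
      divB (torusT (F.P K) 0) (fun κ z => unitsField (toUField U₀) ⟨z, κ⟩)
        (fun κ => covD (torusT (F.P K) 0) (fun κ' z => unitsField (toUField U₀) ⟨z, κ'⟩) κ φ) x = 0) :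
    ∑ x : Site (F.P K) 0, ‖φ x‖ ^ 2 ≤ ((F.L : ℝ) ^ k) ^ 3 * ∑ y : Site (F.P K) k, ‖φ (embIter k y)‖ ^ 2 := by
  classical
  set C : Finset (Site (F.P K) 0) := (Finset.univ : Finset (Site (F.P K) k)).image (embIter k) with hCdef
  have hk' : k ≤ (F.P K).m + (F.P K).K := hk
  have hCne : C.Nonempty := ⟨embIter k default, Finset.mem_image_of_mem _ (Finset.mem_univ _)⟩
  have hU := fun κ (z : Site (F.P K) 0) => mem_U1_of_unitary (unitsField_toUField_mem_unitary U₀ κ z)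
  have hφ' : ∀ x : Site (F.P K) 0, x ∉ C →
      divB (torusT (F.P K) 0) (fun κ z => unitsField (toUField U₀) ⟨z, κ⟩)
        (fun κ => covD (torusT (F.P K) 0) (fun κ' z => unitsField (toUField U₀) ⟨z, κ'⟩) κ φ) x = 0 := by
    intro x hx
    refine hφ x fun ⟨y, hy⟩ => hx ?_
    rw [hCdef, Finset.mem_image]
    exact ⟨y, Finset.mem_univ _, hy⟩
  have hmain := card_mul_sum_norm_sq_le_of_covHarmonic_off (fun κ z => unitsField (toUField U₀) ⟨z, κ⟩) hU C hCne
    (centres_homogeneous k) φ hφ'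
  -- the injectivity of `ι_k` turns the sum over `C` into the sum over `T^{(k)}`
  have hinj : Function.Injective (embIter (P := F.P K) k) := by
    have : ∀ {i : ℕ}, i ≤ (F.P K).m + (F.P K).K → Function.Injective (embIter (P := F.P K) i) := by
      intro i
      induction i with
      | zero => intro _ x y h; exact h
      | succ i ih =>
        intro hi x y h
        have h' : emb x = emb y := ih (Nat.le_of_succ_le hi) h
        rw [← Site.blockOf_emb hi x, ← Site.blockOf_emb hi y, h']
    exact this hk'
  have hsumC : ∑ c ∈ C, ‖φ c‖ ^ 2 = ∑ y : Site (F.P K) k, ‖φ (embIter k y)‖ ^ 2 := by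
    rw [hCdef, Finset.sum_image fun y _ y' _ h => hinj h]
  -- cardinalities: `|C|·(L³)^k = |T_η|`
  have hcard : (C.card : ℝ) * ((F.L : ℝ) ^ k) ^ 3 = (Fintype.card (Site (F.P K) 0) : ℝ) := by
    have h := card_centres_mul_pow (P := F.P K) hk'
    rw [← hCdef, T3Family.P_d] at h
    have hL : (F.P K).L = F.L := rfl
    rw [hL] at h
    calc (C.card : ℝ) * ((F.L : ℝ) ^ k) ^ 3 = ((C.card * (F.L ^ 3) ^ k : ℕ) : ℝ) := by push_cast; ring
      _ = (Fintype.card (Site (F.P K) 0) : ℝ) := by rw [h]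
  have hCpos : (0 : ℝ) < C.card := by exact_mod_cast Finset.card_pos.mpr hCne
  rw [hsumC, ← hcard] at hmain
  -- divide by `|C| > 0`
  have : (C.card : ℝ) * ∑ x : Site (F.P K) 0, ‖φ x‖ ^ 2 ≤ (C.card : ℝ) * (((F.L : ℝ) ^ k) ^ 3 * ∑ y : Site (F.P K) k, ‖φ (embIter k y)‖ ^ 2) := by
    rw [← mul_assoc]; exact hmain
  exact le_of_mul_le_mul_left this hCpos

end T3

end Summit.QuantumFields.YangMills.Theorems.Prop7PinnedHarmonicMass

end
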